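import Summits.Ventures.LatticeQCDFlow.Exactness.IMHTauIntFiniteOfWeightMoment
import HarnessLib

/-!
# `τ_int ≤ ½ + 12 (B²/E_π[g²]) / ESS-fraction`: the chain's autocorrelation time is controlled by the weights' effective sample size

HONEST FRAMING: exact (Metropolis-corrected) sampling algorithms for lattice gauge theory;
figures of merit are autocorrelation/cost numbers at stated couplings and volumes; no
continuum-physics claim.  (SCALAR calibration rung S0-A: not a gauge result.)

Venture `LatticeQCDFlow` (cell pub-lqcd), topic `Exactness`; FANOUT row 2 (`s0-phi4`, FLOW arm).
NEW WORK of the cell: the free parameter `v₀` of `IMHTauIntFiniteOfWeightMoment.lean` chosen at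
the weight scale `v₀ = 2W₂/Z`, where the clipped mass is at least `Z/2` by a Markov-type bound.
The result is a UNIVERSAL, fully explicit inequality between the cell's two figures of merit for
the exact flow sampler: the integrated autocorrelation time of ANY bounded observable along the
exact chain, and the Kish effective-sample-size fraction `κ = Z²/W₂ = (E_q b)²/E_q[b²]` of
i.i.d. importance weights of the same model.  Nothing is cited as a fact.

## What is proved (`w, q > 0` measurable integrable, `∫ q = 1`, `Z = ∫ w`, `b = w/q`,
`W₂ = ∫ b w dμ < ∞`, `M(v) = ∫ min(w, v q)`; `g` measurable, `|g| ≤ B`, centred `∫ g w = 0`,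
`C(k) = ∫ g (Kᵏ g) w`)

* `min_weight_clip_ge` — pointwise `min(w, v q) ≥ w − b w/v`; **`clip_ge`** — `M(v) ≥ Z − W₂/v`;
  `clip_twoScale_ge` — `M(2W₂/Z) ≥ Z/2`; `sq_integral_le_weightMoment` — `Z² ≤ W₂`
  (Cauchy–Schwarz: `κ ≤ 1`);
* **`tsum_autocov_le_invESS`** — `Σ_{k≥1} C(k) ≤ 12 B² W₂/Z`;
* **`imhOp_tauInt_le_invESS`** — on `Scoring.tauInt`:
  `τ_int(g) ≤ ½ + 12 B² W₂ / (Z ∫ g² w dμ) = ½ + 12 (B²/E_π[g²]) / κ`;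
* the lattice (row 2's `imhOpPhi4 J λ q̃`, `g = f − ⟨f⟩`): **`phi4Flow_tauInt_le_invESS`**.

Reading for S0-A (no numerics implied): a flow whose raw importance sampler retains an ESS
fraction `κ` drives an exact chain in which every observable with `sup g² ≤ E_π[g²]/θ`
decorrelates within `τ_int ≤ ½ + 12/(θκ)` steps — the constant `12` is not optimised; the
dependence on `κ` is linear.  Converse direction (`κ = 0` ⇒ some bounded observable has a
non-summable autocovariance series): `IMHTauIntInfiniteOfWeightMoment.lean`.
NOT CLAIMED: sharpness of the constant; HMC / local Metropolis; unbounded observables; any number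
for a trained network.
-/

namespace Summit.Ventures.LatticeQCDFlow.Exactness

open Real MeasureTheory Filter Set Topology
open Summit.Ventures.LatticeQCDFlow.Scoring

variable {X : Type*} [MeasurableSpace X] {μ : Measure X} {w q : X → ℝ}

variable [SFinite μ]

/-! ## The clipped mass at the weight scale `2W₂/Z` -/

omit [MeasurableSpace X] in
/-- Pointwise: `min(w, v q) ≥ w − b w / v` (`v > 0`, `b = w/q`): below level `v` the clip is
inactive, above it the right side is negative. -/
theorem min_weight_clip_ge (hw0 : ∀ t, 0 < w t) (hq0 : ∀ t, 0 < q t) {v : ℝ} (hv : 0 < v)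
    (z : X) : w z - w z / q z * w z / v ≤ min (w z) (v * q z) := by
  have hwz := hw0 z
  have hqz := hq0 z
  have hb0 : 0 ≤ w z / q z * w z / v := div_nonneg (mul_nonneg (div_nonneg hwz.le hqz.le) hwz.le) hv.le
  refine le_min (by linarith) ?_
  -- `w − b w/v ≤ v q` ⟺ `w (1 − b/v) ≤ v q`
  by_cases h : w z / q z ≤ v
  · have h1 : w z ≤ v * q z := (div_le_iff₀ hqz).1 h
    linarith
  · have h' : v < w z / q z := not_le.1 h
    have h2 : w z < w z / q z * w z / v := by
      rw [lt_div_iff₀ hv]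
      calc w z * v < w z * (w z / q z) := mul_lt_mul_of_pos_left h' hwz
        _ = w z / q z * w z := by ring
    have h3 : 0 < v * q z := mul_pos hv hqz
    linarith

omit [SFinite μ] in
/-- **`M(v) ≥ Z − W₂/v`** (`v > 0`): the clipped mass misses at most a Markov tail of the second
weight moment. -/
theorem clip_ge (hw0 : ∀ t, 0 < w t) (hwm : Measurable w) (hwi : Integrable w μ)
    (hq0 : ∀ t, 0 < q t) (hqm : Measurable q) (hW₂ : Integrable (fun x => w x / q x * w x) μ)
    {v : ℝ} (hv : 0 < v) :
    (∫ z, w z ∂μ) - (∫ z, w z / q z * w z ∂μ) / v ≤ ∫ z, min (w z) (v * q z) ∂μ := by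
  obtain ⟨hi, -, -⟩ := integrable_clip hw0 hwm hwi hq0 hqm hv.le
  have e : (∫ z, w z ∂μ) - (∫ z, w z / q z * w z ∂μ) / v = ∫ z, (w z - w z / q z * w z / v) ∂μ := by
    rw [integral_sub hwi (hW₂.div_const v), integral_div]
  rw [e]
  exact integral_mono (hwi.sub (hW₂.div_const v)) hi fun z => min_weight_clip_ge hw0 hq0 hv z

omit [SFinite μ] in
/-- **`Z² ≤ W₂`** when `∫ q = 1` (Cauchy–Schwarz: `(∫ b q)² ≤ ∫ b² q ∫ q`), i.e. the Kish fraction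
`κ = Z²/W₂ ≤ 1`; in particular `W₂ > 0`. -/
theorem sq_integral_le_weightMoment (hwi : Integrable w μ) (hq0 : ∀ t, 0 < q t)
    (hqi : Integrable q μ) (hq1 : ∫ z, q z ∂μ = 1)
    (hW₂ : Integrable (fun x => w x / q x * w x) μ) :
    (∫ z, w z ∂μ) ^ 2 ≤ ∫ z, w z / q z * w z ∂μ := by
  -- `0 ≤ ∫ (b − Z)² q = W₂ − 2 Z² + Z² ∫ q`
  set Z : ℝ := ∫ z, w z ∂μ with hZ
  have hint : Integrable (fun z => (w z / q z - Z) ^ 2 * q z) μ := by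
    have e : (fun z => (w z / q z - Z) ^ 2 * q z)
        = fun z => w z / q z * w z - 2 * Z * w z + Z ^ 2 * q z := by
      funext z
      have hqz := (hq0 z).ne'
      field_simp
      ring
    rw [e]
    exact (hW₂.sub (hwi.const_mul _)).add (hqi.const_mul _)
  have h0 : 0 ≤ ∫ z, (w z / q z - Z) ^ 2 * q z ∂μ :=
    integral_nonneg fun z => mul_nonneg (sq_nonneg _) (hq0 z).le
  have e : ∫ z, (w z / q z - Z) ^ 2 * q z ∂μ = (∫ z, w z / q z * w z ∂μ) - Z ^ 2 := by
    have e1 : ∀ z, (w z / q z - Z) ^ 2 * q z = w z / q z * w z - 2 * Z * w z + Z ^ 2 * q z := by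
      intro z
      have hqz := (hq0 z).ne'
      field_simp
      ring
    simp_rw [e1]
    have i1 : Integrable (fun z => w z / q z * w z - 2 * Z * w z) μ := hW₂.sub (hwi.const_mul _)
    have i2 : Integrable (fun z => Z ^ 2 * q z) μ := hqi.const_mul _
    have i3 : Integrable (fun z => 2 * Z * w z) μ := hwi.const_mul _
    rw [integral_add i1 i2, integral_sub hW₂ i3, integral_const_mul, integral_const_mul, hq1, ← hZ]
    ring
  linarith

omit [SFinite μ] in
/-- **At the weight scale `v₀ = 2W₂/Z` the clipped mass is at least `Z/2`.** -/
theorem clip_twoScale_ge (hw0 : ∀ t, 0 < w t) (hwm : Measurable w) (hwi : Integrable w μ)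
    (hq0 : ∀ t, 0 < q t) (hqm : Measurable q) (hqi : Integrable q μ) (hq1 : ∫ z, q z ∂μ = 1)
    (hW₂ : Integrable (fun x => w x / q x * w x) μ) :
    (∫ z, w z ∂μ) / 2 ≤ ∫ z, min (w z) ((2 * (∫ x, w x / q x * w x ∂μ) / ∫ x, w x ∂μ) * q z) ∂μ := by
  set Z : ℝ := ∫ x, w x ∂μ with hZdef
  set W : ℝ := ∫ x, w x / q x * w x ∂μ with hWdef
  have hZ : 0 < Z := integral_pos_of_pos hw0 hwi hq1
  have hW : 0 < W :=
    (pow_pos hZ 2).trans_le (sq_integral_le_weightMoment hwi hq0 hqi hq1 hW₂)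
  have hv : 0 < 2 * W / Z := by positivity
  have h := clip_ge hw0 hwm hwi hq0 hqm hW₂ hv
  rw [← hZdef, ← hWdef] at h
  have hZne := hZ.ne'
  have hWne := hW.ne'
  have e : Z - W / (2 * W / Z) = Z / 2 := by
    field_simp
    ring
  linarith

/-! ## The bound -/

/-- **`Σ_{k≥1} C(k) ≤ 12 B² W₂/Z`** for every bounded centred observable of the exact flow sampler
with square-integrable weights (the three terms of `hasSum_autocov_le_of_weightMoment` at
`v₀ = 2W₂/Z`, `M(v₀) ≥ Z/2`, contribute `2 + 4 + 6`). -/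
theorem tsum_autocov_le_invESS (hw0 : ∀ t, 0 < w t) (hwm : Measurable w)
    (hwi : Integrable w μ) (hq0 : ∀ t, 0 < q t) (hqm : Measurable q) (hqi : Integrable q μ)
    (hq1 : ∫ z, q z ∂μ = 1) (hW₂ : Integrable (fun x => w x / q x * w x) μ) {g : X → ℝ}
    (hgm : Measurable g) {B : ℝ} (hgb : ∀ t, |g t| ≤ B) (hg0 : ∫ x, g x * w x ∂μ = 0) :
    ∃ s : ℝ, HasSum (fun k => ∫ x, g x * ((imhOp μ w q)^[k + 1] g) x * w x ∂μ) s
      ∧ s ≤ 12 * B ^ 2 * (∫ x, w x / q x * w x ∂μ) / ∫ x, w x ∂μ := by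
  set Z : ℝ := ∫ x, w x ∂μ with hZdef
  set W : ℝ := ∫ x, w x / q x * w x ∂μ with hWdef
  have hZ : 0 < Z := integral_pos_of_pos hw0 hwi hq1
  have hW : 0 < W := (pow_pos hZ 2).trans_le (sq_integral_le_weightMoment hwi hq0 hqi hq1 hW₂)
  have hv₀ : 0 < 2 * W / Z := by positivity
  obtain ⟨s, hs, hle⟩ := hasSum_autocov_le_of_weightMoment hw0 hwm hwi hq0 hqm hqi hq1 hW₂ hgm
    hgb hg0 hv₀
  refine ⟨s, hs, hle.trans ?_⟩
  set m : ℝ := ∫ z, min (w z) (2 * W / Z * q z) ∂μ with hmdef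
  have hm : Z / 2 ≤ m := clip_twoScale_ge hw0 hwm hwi hq0 hqm hqi hq1 hW₂
  have hm0 : 0 < m := (half_pos hZ).trans_le hm
  have hB : 0 ≤ B ^ 2 := sq_nonneg _
  -- the three terms
  have t1 : B ^ 2 * (2 * W / Z) = 2 * (B ^ 2 * W / Z) := by ring
  have t2 : B ^ 2 * (Z * W) / m ^ 2 ≤ 4 * (B ^ 2 * W / Z) := by
    have hm2 : (Z / 2) ^ 2 ≤ m ^ 2 := pow_le_pow_left₀ (half_pos hZ).le hm 2
    calc B ^ 2 * (Z * W) / m ^ 2 ≤ B ^ 2 * (Z * W) / (Z / 2) ^ 2 :=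
          div_le_div_of_nonneg_left (by positivity) (pow_pos (half_pos hZ) 2) hm2
      _ = 4 * (B ^ 2 * W / Z) := by
          have hZne := hZ.ne'
          field_simp
          ring
  have t3 : B ^ 2 * (W + 2 * W / Z * Z) / m ≤ 6 * (B ^ 2 * W / Z) := by
    have e3 : W + 2 * W / Z * Z = 3 * W := by
      have hZne := hZ.ne'
      field_simp
      ring
    rw [e3]
    calc B ^ 2 * (3 * W) / m ≤ B ^ 2 * (3 * W) / (Z / 2) :=
          div_le_div_of_nonneg_left (by positivity) (half_pos hZ) hm
      _ = 6 * (B ^ 2 * W / Z) := by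
          have hZne := hZ.ne'
          field_simp
          ring
  have e : 12 * B ^ 2 * W / Z = 2 * (B ^ 2 * W / Z) + 4 * (B ^ 2 * W / Z) + 6 * (B ^ 2 * W / Z) := by
    ring
  rw [e, t1]
  exact add_le_add (add_le_add le_rfl t2) t3

/-- **`τ_int ≤ ½ + 12 (B²/E_π[g²]) / κ`.**  `w, q > 0` measurable integrable, `∫ q = 1`,
`Z = ∫ w`, `W₂ = ∫ b w dμ < ∞` (`b = w/q`), `κ = Z²/W₂` the Kish effective-sample-size fraction of
i.i.d. model draws; `g` measurable, `|g| ≤ B`, centred.  Then on the tree's `Scoring.tauInt`: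
`τ_int(g) ≤ ½ + 12 B² W₂ / (Z ∫ g² w dμ)` — the integrated autocorrelation time of every bounded
observable along the EXACT flow sampler is at most linear in the inverse ESS fraction. -/
theorem imhOp_tauInt_le_invESS (hw0 : ∀ t, 0 < w t) (hwm : Measurable w)
    (hwi : Integrable w μ) (hq0 : ∀ t, 0 < q t) (hqm : Measurable q) (hqi : Integrable q μ)
    (hq1 : ∫ z, q z ∂μ = 1) (hW₂ : Integrable (fun x => w x / q x * w x) μ) {g : X → ℝ}
    (hgm : Measurable g) {B : ℝ} (hgb : ∀ t, |g t| ≤ B) (hg0 : ∫ x, g x * w x ∂μ = 0) :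
    tauInt (fun k => (∫ x, g x * ((imhOp μ w q)^[k] g) x * w x ∂μ) / ∫ x, g x ^ 2 * w x ∂μ)
      ≤ 1 / 2 + 12 * B ^ 2 * (∫ x, w x / q x * w x ∂μ) / (∫ x, w x ∂μ)
          / ∫ x, g x ^ 2 * w x ∂μ := by
  obtain ⟨s, hs, hle⟩ := tsum_autocov_le_invESS hw0 hwm hwi hq0 hqm hqi hq1 hW₂ hgm hgb hg0
  have hA0 : 0 ≤ ∫ x, g x ^ 2 * w x ∂μ := integral_nonneg fun x => mul_nonneg (sq_nonneg _) (hw0 x).le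
  simp only [tauInt]
  rw [(hs.div_const (∫ x, g x ^ 2 * w x ∂μ)).tsum_eq]
  exact add_le_add le_rfl (div_le_div_of_nonneg_right hle hA0)

/-! ## The lattice: row 2's φ⁴ flow sampler -/

section Lattice

variable {n : ℕ}

/-- **`τ_int ≤ ½ + 12 (B + |⟨f⟩|)² W₂/(Z ∫ g² e^{−S})` FOR THE φ⁴ FLOW SAMPLER.**  Every `λ > 0`,
real `J`, positive measurable model density `q̃` with `∫ q̃ = 1` and finite second weight moment
`W₂ = ∫ (e^{−S}/q̃) e^{−S} dφ`; `f` bounded measurable, `g = f − ⟨f⟩`, `Z = ∫ e^{−S}`. -/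
theorem phi4Flow_tauInt_le_invESS {lam : ℝ} (hlam : 0 < lam)
    (J : Fin (n + 1) → Fin (n + 1) → ℝ) {q : (Fin (n + 1) → ℝ) → ℝ} (hq0 : ∀ φ, 0 < q φ)
    (hqm : Measurable q) (hqi : Integrable q) (hq1 : ∫ φ, q φ = 1)
    (hW₂ : Integrable (fun φ => gibbsWeight J lam φ / q φ * gibbsWeight J lam φ))
    {f : (Fin (n + 1) → ℝ) → ℝ} (hfm : Measurable f) {B : ℝ} (hfb : ∀ φ, |f φ| ≤ B) :
    tauInt (fun k => (∫ φ, (f φ - gibbsExpect J lam f)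
        * ((imhOpPhi4 J lam q)^[k] (fun ψ => f ψ - gibbsExpect J lam f)) φ * gibbsWeight J lam φ)
        / ∫ φ, (f φ - gibbsExpect J lam f) ^ 2 * gibbsWeight J lam φ)
      ≤ 1 / 2 + 12 * (B + |gibbsExpect J lam f|) ^ 2
          * (∫ φ, gibbsWeight J lam φ / q φ * gibbsWeight J lam φ) / (∫ φ, gibbsWeight J lam φ)
          / ∫ φ, (f φ - gibbsExpect J lam f) ^ 2 * gibbsWeight J lam φ := by
  obtain ⟨hgm, hgb, hg0⟩ := centred_observable hlam J hfm hfb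
  rw [imhOpPhi4_eq_imhOp]
  exact imhOp_tauInt_le_invESS (μ := volume) (fun ψ => gibbsWeight_pos J lam ψ)
    (continuous_gibbsWeight J lam).measurable (integrable_gibbsWeight hlam J) hq0 hqm hqi hq1
    hW₂ hgm hgb hg0

end Lattice

end Summit.Ventures.LatticeQCDFlow.Exactness
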